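import Summits.Ventures.PercRepro.MSTightMerge

/-!
# The one-outside-vertex case (Theorem B of Addendum 38 §4), part I: the setting, the product
# structure of the partner family, and the shape of `U_u`, `T₀`, `Λ`

Dossier proofs/MINE1-theoremS.md, Addendum 38 §4 (a)–(c), and proofs/MINE1-RSTARM-PROOF.md §4.
A **one-vertex residue instance** (`OneVertexData u L' T m`) is an instance `RInst (insert m u) L' T u`
with `m ∉ u`, `T` not tight, some member through `m`, and NO witness; Theorem B says it does not
exist. Write `K = partner m T` (the members `k ⊆ u` with `insert m k ∈ T`), `R = R*(K)`,
`Y = diffsY m T` (the differences through `m`, with `m` removed), `T₀ = part0 m T` (the members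
inside `u`), `T₁ = partr m T` (the members through `m`, with `m` removed), `P = proj m T`.
This module records:
* the (NT) data at `m`: `K` is tight and nonempty, `Y = K \\ K` is a down-set, `R ∈ K`,
  `t ∪ R ∈ K` for `t ∈ T₁` (MSTightInstance.lean, ExcessOneNonTightening.lean);
* **the product structure of `K`** (Theorem S, `tight_eq_sups_of_tight`): `K = L_K ⊻ U'` with
  `L_K = {x ∈ Y : x ∩ R = ∅}` and `U' = {R ∖ y : y ∈ Y, y ⊆ R}`;
* **the shape of `U_u`, `T₀`, `Λ`** in terms of `R` and `Y`: `U_u = {x ⊆ u : R ∖ x ∈ Y}`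
  (a member of `U` inside `u` contains a minimal one, which is a partner member inside `R` by
  (F7)), `T₀ = U_u ∖ {u}` ((S1)), `Λ = {g ⊆ u : g ∩ R ∈ Y}`;
* `N := u ∖ R` is nonempty and **`N ∉ Y`** (an element of `N` in a difference of `K` inside `N`
  would be addable, hence in `R`), so no member of `T₁` contains `N`.
-/

namespace PercRepro.MSTight

open Finset
open scoped FinsetFamily

variable {α : Type*} [DecidableEq α]

/-- A one-vertex residue instance without a witness (the hypotheses of Theorem B, by
contradiction). -/
structure OneVertexData (u : Finset α) (L' T : Finset (Finset α)) (m : α) : Prop where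
  /-- the instance on `insert m u` -/
  inst : RInst (insert m u) L' T u
  /-- `m ∉ u` -/
  hmu : m ∉ u
  /-- `T` is not tight (the residue case) -/
  hnt : ¬ Tight T
  /-- some member passes through `m` -/
  hmT : ∃ y ∈ T, m ∈ y
  /-- no witness -/
  hnw : ∀ t ∈ T, t ∉ L'

namespace OneVertexData

variable {u : Finset α} {L' T : Finset (Finset α)} {m : α}

/-- `{m} ∉ U`: `(insert m u).erase m = u ∉ L'`. -/
theorem erase_notMem (d : OneVertexData u L' T m) : (insert m u).erase m ∉ L' := by
  rw [erase_insert d.hmu]; exact d.inst.hu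

/-- No singleton of `ū` lies in `U`. -/
theorem hB (d : OneVertexData u L' T m) :
    ∀ m' ∈ insert m u \ u, (insert m u).erase m' ∉ L' := by
  intro m' hm'
  rw [mem_sdiff, mem_insert] at hm'
  rcases hm'.1 with rfl | h
  · exact d.erase_notMem
  · exact absurd h hm'.2

/-- Some member lies outside `u`. -/
theorem hout (d : OneVertexData u L' T m) : ∃ y ∈ T, ¬ y ⊆ u := by
  obtain ⟨y, hy, hmy⟩ := d.hmT
  exact ⟨y, hy, fun h => d.hmu (h hmy)⟩

/-- The (NT) count at `m`. -/
theorem hε (d : OneVertexData u L' T m) :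
    (diffsX m T ∩ diffsY m T).card = (partner m T).card :=
  d.inst.nonTightening d.hnt d.hmu d.erase_notMem

/-- The partner family is nonempty. -/
theorem hK (d : OneVertexData u L' T m) : (partner m T).Nonempty := by
  obtain ⟨y, hy, hmy⟩ := d.hmT
  exact d.inst.partner_nonempty d.hnt d.hmu d.erase_notMem hy hmy

/-- The partner family is tight. -/
theorem tight_partner (d : OneVertexData u L' T m) : Tight (partner m T) :=
  (tight_partner_of_card_eq d.hε).1

/-- The differences of `T` are the faces. -/
theorem diffs_eq (d : OneVertexData u L' T m) :
    T \\ T = L'.filter fun w => ∃ y ∈ T, w ⊆ y :=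
  d.inst.diffs_eq_faces d.hnt

/-- Members of `T₁` lie inside `u`. -/
theorem subset_of_mem_partr (d : OneVertexData u L' T m) {t : Finset α} (ht : t ∈ partr m T) :
    t ⊆ u := by
  obtain ⟨hmt, ht'⟩ := mem_partr.1 ht
  intro a ha
  have := d.inst.hTS _ ht' (mem_insert_of_mem ha)
  rw [mem_insert] at this
  rcases this with rfl | h
  · exact absurd ha hmt
  · exact h

/-- Members of `T₀` lie inside `u`. -/
theorem subset_of_mem_part0 (d : OneVertexData u L' T m) {x : Finset α} (hx : x ∈ part0 m T) :
    x ⊆ u := by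
  obtain ⟨hx', hmx⟩ := mem_part0.1 hx
  intro a ha
  have := d.inst.hTS _ hx' ha
  rw [mem_insert] at this
  rcases this with rfl | h
  · exact absurd ha hmx
  · exact h

/-- Members of `K` lie inside `u`. -/
theorem subset_of_mem_partner (d : OneVertexData u L' T m) {k : Finset α} (hk : k ∈ partner m T) :
    k ⊆ u := d.subset_of_mem_part0 (mem_inter.1 hk).1

/-- `Y` is a down-set (the faces form a down-set). -/
theorem isDownSet_diffsY (d : OneVertexData u L' T m) : IsDownSet (diffsY m T) := by
  intro E hE E' hE'
  rw [mem_diffsY_iff] at hE ⊢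
  refine ⟨fun h => hE.1 (hE' h), ?_⟩
  rw [d.diffs_eq] at hE ⊢
  exact mem_faces_of_subset d.inst.hdown hE.2 (insert_subset_insert m hE')

/-- The differences avoiding `m` are the faces avoiding `m`. -/
theorem mem_diffsX_iff' (d : OneVertexData u L' T m) {E : Finset α} :
    E ∈ diffsX m T ↔ E ∈ L' ∧ m ∉ E ∧ ∃ y ∈ T, E ⊆ y := by
  rw [mem_diffsX_iff, d.diffs_eq, mem_filter]
  tauto

/-- `|X| = |P| + 1`. -/
theorem card_diffsX (d : OneVertexData u L' T m) :
    (diffsX m T).card = (proj m T).card + 1 :=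
  d.inst.card_diffsX d.hnt d.hmu d.erase_notMem

section Fin

variable [Fintype α]

/-- `Y = K \\ K`. -/
theorem diffsY_eq (d : OneVertexData u L' T m) :
    diffsY m T = partner m T \\ partner m T :=
  diffsY_eq_diffs_partner_of_nonTightening d.hε d.hK

/-- `R ∈ K`. -/
theorem Rstar_mem (d : OneVertexData u L' T m) : Rstar (partner m T) ∈ partner m T :=
  Rstar_partner_mem d.hε d.hK

/-- `t ∪ R ∈ K` for every `t ∈ T₁`. -/
theorem union_Rstar_mem (d : OneVertexData u L' T m) {t : Finset α} (ht : t ∈ partr m T) :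
    t ∪ Rstar (partner m T) ∈ partner m T :=
  union_Rstar_mem_partner d.hε d.hK ht

/-- `R ⊆ u`. -/
theorem Rstar_subset (d : OneVertexData u L' T m) : Rstar (partner m T) ⊆ u :=
  d.subset_of_mem_partner d.Rstar_mem

/-- **(S1).** Every member of `U` strictly inside `u` is a member of `T`. -/
theorem hS1 (d : OneVertexData u L' T m) :
    ∀ x ∈ upSet (insert m u) L', x ⊆ u → x ≠ u → x ∈ T :=
  d.inst.mem_of_mem_upSet_of_ne_of_noWitness d.hnt d.hB d.hout d.hnw

/-- For `x ⊆ u`: `x ∈ U ↔ insert m (u \ x) ∈ L'`. -/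
theorem mem_upSet_iff (d : OneVertexData u L' T m) {x : Finset α} (hxu : x ⊆ u) :
    x ∈ upSet (insert m u) L' ↔ insert m (u \ x) ∈ L' := by
  rw [mem_upSet, insert_sdiff_of_notMem u (fun h => d.hmu (hxu h))]

/-- `T₀ = U_u \ {u}`: membership in `T₀`. -/
theorem mem_part0_iff (d : OneVertexData u L' T m) {x : Finset α} :
    x ∈ part0 m T ↔ x ⊆ u ∧ x ≠ u ∧ x ∈ upSet (insert m u) L' := by
  constructor
  · intro hx
    refine ⟨d.subset_of_mem_part0 hx, fun h => d.inst.not_subset_of_mem (mem_part0.1 hx).1 (h ▸ subset_refl u),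
      d.inst.subset_upSet (mem_part0.1 hx).1⟩
  · rintro ⟨hxu, hxne, hxU⟩
    exact mem_part0.2 ⟨d.hS1 x hxU hxu hxne, fun h => d.hmu (hxu h)⟩

/-- Membership in `Λ = link U u`: `g ∈ Λ ↔ g ⊆ u ∧ insert m g ∈ L'`. -/
theorem mem_link_iff (d : OneVertexData u L' T m) {g : Finset α} :
    g ∈ link (upSet (insert m u) L') u ↔ g ⊆ u ∧ insert m g ∈ L' := by
  rw [mem_link]
  constructor
  · rintro ⟨hgu, hg⟩
    rw [d.mem_upSet_iff sdiff_subset, Finset.sdiff_sdiff_eq_self hgu] at hg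
    exact ⟨hgu, hg⟩
  · rintro ⟨hgu, hg⟩
    refine ⟨hgu, ?_⟩
    rw [d.mem_upSet_iff sdiff_subset, Finset.sdiff_sdiff_eq_self hgu]
    exact hg

/-- The members of `Λ` lie in `L'`. -/
theorem mem_of_mem_link' (d : OneVertexData u L' T m) {g : Finset α}
    (hg : g ∈ link (upSet (insert m u) L') u) : g ∈ L' :=
  d.inst.hdown _ (d.mem_link_iff.1 hg).2 _ (subset_insert m g)

section Product

/-- `L_K`: the differences of `K` avoiding `R` (the down-set factor of Theorem S). -/
theorem mem_LK_iff {x : Finset α} :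
    x ∈ within (diffsY m T) (univ \ Rstar (partner m T)) ↔
      x ∈ diffsY m T ∧ Disjoint x (Rstar (partner m T)) := by
  rw [mem_within, subset_sdiff]
  simp only [subset_univ, true_and]

/-- **Theorem S for `K`:** `K = L_K ⊻ U'` with `L_K = {x ∈ Y : x ∩ R = ∅}` and
`U' = {R \ y : y ∈ Y, y ⊆ R}`. -/
theorem partner_eq_sups (d : OneVertexData u L' T m) :
    partner m T = within (diffsY m T) (univ \ Rstar (partner m T)) ⊻
      complWithin (Rstar (partner m T)) (within (diffsY m T) (Rstar (partner m T))) := by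
  have h := tight_eq_sups_of_tight d.tight_partner
  rw [← diffs_eq_flip_of_tight d.tight_partner, ← d.diffsY_eq] at h
  exact h

/-- A member of `K` decomposes: `k \ R ∈ L_K`, i.e. `k \ R ∈ Y`. -/
theorem sdiff_Rstar_mem_diffsY (d : OneVertexData u L' T m) {k : Finset α}
    (hk : k ∈ partner m T) : k \ Rstar (partner m T) ∈ diffsY m T := by
  rw [d.partner_eq_sups] at hk
  obtain ⟨x, hx, z, hz, hxz⟩ := mem_sups.1 hk
  rw [sup_eq_union] at hxz
  obtain ⟨hxY, hxR⟩ := mem_LK_iff.1 hx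
  obtain ⟨y, -, rfl⟩ := mem_complWithin.1 hz
  have : (x ∪ (Rstar (partner m T) \ y)) \ Rstar (partner m T) = x := by
    ext b
    simp only [mem_sdiff, mem_union]
    constructor
    · rintro ⟨h | h, hbR⟩
      · exact h
      · exact absurd h.1 hbR
    · intro hb
      exact ⟨Or.inl hb, disjoint_left.1 hxR hb⟩
  rw [← hxz, this]; exact hxY

/-- A member of `K` decomposes: `R \ k ∈ Y`. -/
theorem Rstar_sdiff_mem_diffsY (d : OneVertexData u L' T m) {k : Finset α}
    (hk : k ∈ partner m T) : Rstar (partner m T) \ k ∈ diffsY m T := by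
  rw [d.partner_eq_sups] at hk
  obtain ⟨x, hx, z, hz, hxz⟩ := mem_sups.1 hk
  rw [sup_eq_union] at hxz
  obtain ⟨-, hxR⟩ := mem_LK_iff.1 hx
  obtain ⟨y, hy, rfl⟩ := mem_complWithin.1 hz
  obtain ⟨hyY, hyR⟩ := mem_within.1 hy
  have : Rstar (partner m T) \ (x ∪ (Rstar (partner m T) \ y)) = y := by
    rw [sdiff_union_distrib, sdiff_eq_self_of_disjoint hxR.symm, Finset.sdiff_sdiff_eq_self hyR]
    exact inter_eq_right.2 hyR
  rw [← hxz, this]; exact hyY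

/-- Conversely, `x ∪ (R \ y) ∈ K` for `x ∈ Y` disjoint from `R` and `y ∈ Y` inside `R`. -/
theorem union_sdiff_mem_partner (d : OneVertexData u L' T m) {x y : Finset α}
    (hx : x ∈ diffsY m T) (hxR : Disjoint x (Rstar (partner m T))) (hy : y ∈ diffsY m T)
    (hyR : y ⊆ Rstar (partner m T)) : x ∪ (Rstar (partner m T) \ y) ∈ partner m T := by
  have hmem : x ∪ (Rstar (partner m T) \ y) ∈ within (diffsY m T) (univ \ Rstar (partner m T)) ⊻
      complWithin (Rstar (partner m T)) (within (diffsY m T) (Rstar (partner m T))) :=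
    mem_sups.2 ⟨x, mem_LK_iff.2 ⟨hx, hxR⟩, _, mem_complWithin.2 ⟨y, mem_within.2 ⟨hy, hyR⟩, rfl⟩,
      sup_eq_union⟩
  rwa [← d.partner_eq_sups] at hmem

/-- `∅ ∈ Y`. -/
theorem empty_mem_diffsY (d : OneVertexData u L' T m) : (∅ : Finset α) ∈ diffsY m T := by
  rw [d.diffsY_eq]
  obtain ⟨k, hk⟩ := d.hK
  exact mem_diffs.2 ⟨k, hk, k, hk, Finset.sdiff_self k⟩

/-- `R ∩ x ∈ K` for every `x` with `R \ x ∈ Y`. -/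
theorem inter_mem_partner_of_sdiff_mem (d : OneVertexData u L' T m) {x : Finset α}
    (hx : Rstar (partner m T) \ x ∈ diffsY m T) : Rstar (partner m T) ∩ x ∈ partner m T := by
  have := d.union_sdiff_mem_partner d.empty_mem_diffsY (disjoint_empty_left _) hx sdiff_subset
  rwa [empty_union, sdiff_sdiff_right_self, inf_eq_inter] at this

end Product

section Shape

/-- **The shape of `U_u`:** for `x ⊆ u`, `x ∈ U ↔ R \ x ∈ Y`. -/
theorem mem_upSet_iff_sdiff_mem (d : OneVertexData u L' T m) {x : Finset α} (hxu : x ⊆ u) :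
    x ∈ upSet (insert m u) L' ↔ Rstar (partner m T) \ x ∈ diffsY m T := by
  constructor
  · intro hx
    -- a minimal member of `U` below `x` is a partner member inside `R`
    obtain ⟨z, hz, hzx, hzmin⟩ := RInst.exists_minimal_upSet hx
    obtain ⟨y, hy, hmy⟩ := d.hmT
    obtain ⟨hzK, hzR⟩ := d.inst.mem_partner_and_subset_Rstar_of_minimal d.hnt d.hmu d.erase_notMem
      hy hmy (hzx.trans hxu) (mem_upSet.1 hz) (fun x' _ hx' hx'z => hzmin x' hx' hx'z)
    have h1 := d.Rstar_sdiff_mem_diffsY hzK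
    exact d.isDownSet_diffsY _ h1 _ (sdiff_subset_sdiff (subset_refl _) hzx)
  · intro hx
    have hk := d.inter_mem_partner_of_sdiff_mem hx
    exact d.inst.upSet_up _ (d.inst.subset_upSet (RInst.mem_of_mem_partner hk)) _ inter_subset_right

/-- **The shape of `T₀`:** `x ∈ T₀ ↔ x ⊆ u ∧ x ≠ u ∧ R \ x ∈ Y`. -/
theorem mem_part0_iff' (d : OneVertexData u L' T m) {x : Finset α} :
    x ∈ part0 m T ↔ x ⊆ u ∧ x ≠ u ∧ Rstar (partner m T) \ x ∈ diffsY m T := by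
  rw [d.mem_part0_iff]
  constructor
  · rintro ⟨hxu, hxne, hx⟩
    exact ⟨hxu, hxne, (d.mem_upSet_iff_sdiff_mem hxu).1 hx⟩
  · rintro ⟨hxu, hxne, hx⟩
    exact ⟨hxu, hxne, (d.mem_upSet_iff_sdiff_mem hxu).2 hx⟩

/-- **The shape of `Λ`:** `g ∈ Λ ↔ g ⊆ u ∧ g ∩ R ∈ Y`. -/
theorem mem_link_iff' (d : OneVertexData u L' T m) {g : Finset α} :
    g ∈ link (upSet (insert m u) L') u ↔ g ⊆ u ∧ g ∩ Rstar (partner m T) ∈ diffsY m T := by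
  rw [mem_link]
  have hRu := d.Rstar_subset
  constructor
  · rintro ⟨hgu, hg⟩
    rw [d.mem_upSet_iff_sdiff_mem sdiff_subset] at hg
    refine ⟨hgu, ?_⟩
    have : Rstar (partner m T) \ (u \ g) = g ∩ Rstar (partner m T) := by
      ext a; simp only [mem_sdiff, mem_inter, not_and, not_not]
      constructor
      · rintro ⟨haR, h⟩; exact ⟨h (hRu haR), haR⟩
      · rintro ⟨hag, haR⟩; exact ⟨haR, fun _ => hag⟩
    rw [this] at hg; exact hg
  · rintro ⟨hgu, hg⟩
    refine ⟨hgu, ?_⟩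
    rw [d.mem_upSet_iff_sdiff_mem sdiff_subset]
    have : Rstar (partner m T) \ (u \ g) = g ∩ Rstar (partner m T) := by
      ext a; simp only [mem_sdiff, mem_inter, not_and, not_not]
      constructor
      · rintro ⟨haR, h⟩; exact ⟨h (hRu haR), haR⟩
      · rintro ⟨hag, haR⟩; exact ⟨haR, fun _ => hag⟩
    rw [this]; exact hg

/-- `R ≠ u`, so `N = u \ R` is nonempty. -/
theorem sdiff_Rstar_nonempty (d : OneVertexData u L' T m) :
    (u \ Rstar (partner m T)).Nonempty := by
  rw [nonempty_iff_ne_empty]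
  intro h
  have hRu : u ⊆ Rstar (partner m T) := sdiff_eq_empty_iff_subset.1 h
  exact d.inst.not_subset_of_mem (RInst.mem_of_mem_partner d.Rstar_mem) hRu

/-- **`N ∉ Y`.** If `N = u \ R` were a difference of `K`, every element of `N` would be addable
for `K`, hence in `R`. -/
theorem sdiff_Rstar_notMem_diffsY (d : OneVertexData u L' T m) :
    u \ Rstar (partner m T) ∉ diffsY m T := by
  intro hN
  obtain ⟨a, ha⟩ := d.sdiff_Rstar_nonempty
  have haR : a ∉ Rstar (partner m T) := (mem_sdiff.1 ha).2
  apply haR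
  rw [mem_Rstar]
  -- the twin class of `a` is `{a}`
  have hsing : ({a} : Finset α) ∈ diffsY m T :=
    d.isDownSet_diffsY _ hN _ (singleton_subset_iff.2 ha)
  have hcls : cls (partner m T) a = {a} := by
    apply Subset.antisymm
    · rw [d.diffsY_eq] at hsing
      exact cls_subset_of_twinClosed (twinClosed_of_mem_diffs hsing) (mem_singleton_self a)
    · exact singleton_subset_iff.2 (self_mem_cls _ a)
  rw [hcls]
  -- every member `k ∪ {a}` is a member: `k = x ∪ (R \ y)` and `x ∪ {a} ⊆ N ∈ Y`
  intro k hk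
  have hkR := d.sdiff_Rstar_mem_diffsY hk
  have hRk := d.Rstar_sdiff_mem_diffsY hk
  have hk' := d.union_sdiff_mem_partner (x := (k \ Rstar (partner m T)) ∪ {a})
    (y := Rstar (partner m T) \ k) ?_ ?_ hRk sdiff_subset
  · have : (k \ Rstar (partner m T)) ∪ {a} ∪ (Rstar (partner m T) \ (Rstar (partner m T) \ k)) =
        k ∪ {a} := by
      rw [sdiff_sdiff_right_self, inf_eq_inter]
      ext b
      simp only [mem_union, mem_sdiff, mem_singleton, mem_inter]
      tauto
    rw [this] at hk'; exact hk'
  · refine d.isDownSet_diffsY _ hN _ ?_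
    intro b hb
    rw [mem_union, mem_singleton] at hb
    rcases hb with hb | rfl
    · rw [mem_sdiff] at hb ⊢
      exact ⟨d.subset_of_mem_partner hk hb.1, hb.2⟩
    · exact ha
  · rw [disjoint_left]
    intro b hb hbR
    rw [mem_union, mem_singleton] at hb
    rcases hb with hb | rfl
    · exact (mem_sdiff.1 hb).2 hbR
    · exact haR hbR

/-- No member of `T₁` contains `N`: `t \ R ∈ Y` while `N ∉ Y`. -/
theorem not_sdiff_subset_of_mem_partr (d : OneVertexData u L' T m) {t : Finset α}
    (ht : t ∈ partr m T) : ¬ u \ Rstar (partner m T) ⊆ t := by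
  intro hNt
  have h1 := d.sdiff_Rstar_mem_diffsY (d.union_Rstar_mem ht)
  rw [union_sdiff_right] at h1
  have : t \ Rstar (partner m T) = u \ Rstar (partner m T) :=
    Subset.antisymm (sdiff_subset_sdiff (d.subset_of_mem_partr ht) (subset_refl _))
      (fun a ha => mem_sdiff.2 ⟨hNt ha, (mem_sdiff.1 ha).2⟩)
  rw [this] at h1
  exact d.sdiff_Rstar_notMem_diffsY h1

end Shape

end Fin

end OneVertexData

end PercRepro.MSTight
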